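import Summits.HodgeConjecture.HodgeConjecture.Theorems.Ring2HypothesesDescentAbsoluteSemisimple
import Mathlib.RingTheory.Artinian.Module
import HarnessLib

/-!
# Ring 2 — hypotheses layer, descent axis: DELIGNE–MILNE II PROP. 6.3 (NOTE) / 6.5 IN OPERATOR FORM — for every smooth
# projective complex `X` and every degree `a`, the `ℂ`-algebra of endomorphisms of `Hᵃ(X(ℂ); ℂ)` induced by
# `S^n(X ⊗ X) := span_ℂ {absolute Hodge classes of codimension n on X ⊗ X}` is SEMISIMPLE, and `Hᵃ(X(ℂ); ℂ)` is completely
# reducible under absolute Hodge endo-correspondences (mod the six facts of record; NO `B(X)`)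

HONEST FRAMING (page 1, verbatim the cell's standing line): **research route conditional on HC_CM; not a
corollary; Q11.4-sentence-2 already refuted in dim ≥ 3.** Nothing in this file proves a case of the Hodge conjecture;
nothing discharges the binder of record b06 `Ring2.Hypotheses.AbsoluteHodgeImpliesAlgebraicAV` («absolute Hodge classes
on complex abelian varieties are algebraic», `Ring2HypothesesDescent.lean` :73; OPEN); the binder table's numbers do not
move. `HC_CM` (`Theses.RankFourFaces.CMAbelianHodge`) does not occur in this file; row b06 does not occur in this file.

Hodge ladder STAGE 3, `BINDER-OWNERS.md` row **b06**, seat `ring2-b06` (gen 78); companion of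
`Ring2HypothesesDescentAbsoluteSemisimple` (same gen: composition of absolute Hodge correspondences, absolute Hodge Künneth
projectors, Jannsen's lemma for `S`, nil ⟹ zero). The absolute-Hodge twin of ring2-b05 gen 37's
`isSemisimpleRing_adjoin_algebraicOperators_of_standardConjectureBStar` (Jannsen 1992 Thm. 1 / Kleiman 1968 Thm. 3.11 under
`B(X, η)`): on the ABSOLUTE road the conclusion is unconditional modulo the six named facts of record already displayed by
gens 76–77 — (N) `chartConjugation_canonical`, (E) existence of `σ`-conjugates, V-B3 `deligne1982_cycleClass_absoluteHodge`,
T1c `deligne1982_lefschetz_absoluteHodge_iff`, CS7 `deligne1982_cupProduct_absoluteHodge`, CS8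
`deligne1982_gysinFst_absoluteHodge`. In print: Deligne–Milne 1982 II Prop. 6.3, Note «the proposition shows that
`Mor⁰_AH(X,X)` is a semisimple ℚ-algebra (see 4.5)», and Prop. 6.5 «`M_k` is a semisimple Tannakian category over ℚ»
(proof by Hodge positivity `Tr(uu') > 0`); here by Jannsen's route (finite-dimensional ⟹ Artinian; the nilpotent Jacobson
radical acts as zero by the companion's `corrAction_eq_zero_of_forall_isNilpotent_comp_absoluteHodge`).

* `adjoin_absoluteHodgeOperators_eq` — the image of `S^n(X ⊗ X)` in `End_ℂ Hᵃ(X(ℂ); ℂ)` is a unital subalgebra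
  (`1 = [Δ]_*`, composition; mod (N)+(E)+V-B3+CS7+CS8).
* **`isSemisimpleRing_adjoin_absoluteHodgeOperators` — DM II PROP. 6.3 (NOTE) IN OPERATOR FORM** (mod the six facts),
  `isSemisimpleModule_absoluteHodgeOperators`, and **`exists_isCompl_of_absoluteHodgeOperators_stable` — COMPLETE
  REDUCIBILITY**: every `ℂ`-subspace of `Hᵃ(X(ℂ); ℂ)` stable under all `[u]_*`, `u ∈ S^n(X ⊗ X)`, has a stable complement
  (DM II 6.5 / Lemma 6.6: subobjects of motives for absolute Hodge cycles are direct summands — realisation level, one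
  variety, one degree).

REVISION (gen 78, docstring-only; statements and proofs byte-identical): the semisimplicity Note of Deligne–Milne II
follows PROP. 6.3 (transpose `u'`, `Tr(uu') > 0`), not 6.2 — (6.2) defines the forms `ψʳ`; locators corrected after the
table pen's reading (lit-reduction g46, INBOX l.1724).

HONEST COLUMN. Nothing is discharged; «10 · 0» unchanged; row b06, `HC_AV`, `HC_CM` do not occur; the six facts are named
facts OF RECORD occurring only as displayed hypotheses `hN`, `hex`, `hZ`, `hL`, `hcup`, `hgys`; no definition, no new named
fact, no sorry. NOT obtained: the `ℚ`-structure `Mor⁰_AH(X,X)` itself (the tree's `IsAbsoluteHodgeClass` is not additive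
without (N)+(E), so the `ℂ`-span is used throughout, as in gens 76–77); DM's positivity `Tr(uu') > 0`; the Tannakian
statements II 6.5 / 6.7 beyond one variety and one degree.

PRESEARCH. «algebra of absolute Hodge self-correspondences semisimple» → [corpus: book:deligne1982-hodge-cycles-motives-
shimura-varieties p0145 (II (6.2), Prop. 6.3) / p0146 L1–5 (end of Prop. 6.3 and the Note), p0147 L28 / p0148 L5–14 (II Prop. 6.5 and its proof), re-opened
this session]; corpus hybrid «motives for absolute Hodge cycles semisimple Tannakian Jannsen» top = Green–Murre–Voisin
LNM 1594, DM LNM 900, Jannsen LNM 1400, Charles–Schnell; galaxy all stars «absolute Hodge correspondence|absolutely Hodge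
correspondence|motives for absolute Hodge» → MN-49, Jannsen LNM 1400 only — no operator-level statement on the real
carriers in print ⇒ certification by assembly (Jannsen's route in place of DM's positivity route); no novelty claimed.

References (bib keys): DeligneMilne1982Tannakian (II Prop. 6.1, (6.2), Prop. 6.3 and Note, Prop. 6.5, Lemma 6.6), Jannsen1992 (Lemma 1,
Thm. 1), Kleiman1968AlgebraicCycles (§3 Prop. 3.5, Thm. 3.11), Deligne1982HodgeCycles (§2 Ex. 2.1), Fulton1998 (§16.1
Prop. 16.1.1), CharlesSchnell2014Notes (Def. 11.2.3, Prop. 11.2.7–11.2.8).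
-/

noncomputable section

set_option linter.dupNamespace false

open CategoryTheory AlgebraicGeometry MonoidalCategory CartesianMonoidalCategory
open Literature.AlgebraicTopology.SingularHomology Literature.Geometry.Kaehler
open Literature.AlgebraicGeometry Literature.AlgebraicGeometry.Motives
open Literature.AlgebraicGeometry.HodgeTheory
open Summit.HodgeConjecture.HodgeConjecture.Theorems

namespace Summit.HodgeConjecture.HodgeConjecture.Ring2.Hypotheses

/-! ## §1 Deligne–Milne II Prop. 6.3 (Note) in operator form: the algebra of absolute Hodge endo-correspondence operators on
`Hᵃ(X(ℂ); ℂ)` is semisimple; complete reducibility (continuing the companion's §1–§3) -/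

section Semisimple

variable {n : ℕ} {X : SchemeOver ℂ}

/-- **The image of `S^n(X ⊗ X)` in `End_ℂ Hᵃ(X(ℂ); ℂ)` is a unital subalgebra** (it contains `1 = [Δ]_*` and is closed under
composition — the companion's `exists_diagonalClass_mem_span_absoluteHodge`, `exists_corrCompClass_mem_span_absoluteHodge`): the subalgebra it generates equals it as a set (mod (N)+(E)+V-B3+CS7+CS8).
[cite: DeligneMilne1982Tannakian, II Prop. 6.1 and §6.3] [cite: Fulton1998, §16.1 Prop. 16.1.1] -/
theorem adjoin_absoluteHodgeOperators_eq (hN : chartConjugation_canonical)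
    (hex : ∀ ⦃n : ℕ⦄ ⦃X : SchemeOver ℂ⦄, IsSmoothProjective n X →
      ∀ (σ : ℂ ≃+* ℂ) (p : ℕ) (c : complexBetti X (2 * p)), ∃ s, IsConjugateClass σ X (2 * p) c s)
    (hZ : deligne1982_cycleClass_absoluteHodge) (hcup : deligne1982_cupProduct_absoluteHodge)
    (hgys : deligne1982_gysinFst_absoluteHodge) (hX : IsSmoothProjective n X) (a : ℕ) :
    (Algebra.adjoin ℂ ((Submodule.span ℂ {c : complexBetti (X ⊗ X) (2 * n) |
        IsAbsoluteHodgeClass (n + n) (X ⊗ X) n c}).map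
        (corrAction complexOrientationFamily hX hX (rfl : a + 2 * n = a + 2 * n)) :
          Set (Module.End ℂ (complexBetti X a))) : Set (Module.End ℂ (complexBetti X a))) =
      (Submodule.span ℂ {c : complexBetti (X ⊗ X) (2 * n) | IsAbsoluteHodgeClass (n + n) (X ⊗ X) n c}).map
        (corrAction complexOrientationFamily hX hX (rfl : a + 2 * n = a + 2 * n)) := by
  set M := (Submodule.span ℂ {c : complexBetti (X ⊗ X) (2 * n) | IsAbsoluteHodgeClass (n + n) (X ⊗ X) n c}).map
    (corrAction complexOrientationFamily hX hX (rfl : a + 2 * n = a + 2 * n)) with hM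
  have hone : (1 : Module.End ℂ (complexBetti X a)) ∈ M := by
    obtain ⟨δ, hδ, hδa⟩ := exists_diagonalClass_mem_span_absoluteHodge hZ hX
    refine ⟨δ, hδ, ?_⟩
    rw [hδa a, Module.End.one_eq_id]
  have hmul : ∀ S ∈ M, ∀ T ∈ M, S * T ∈ M := by
    rintro S ⟨γ, hγ, rfl⟩ T ⟨γ', hγ', rfl⟩
    obtain ⟨γ'', hγ'', hact⟩ := exists_corrCompClass_mem_span_absoluteHodge hN hex hZ hcup hgys hX hX hX
      (e := n) (e' := n) (e'' := n) rfl hγ hγ'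
    refine ⟨γ'', hγ'', ?_⟩
    rw [Module.End.mul_eq_comp, hact (a := a) (a₁ := a) (a₂ := a) rfl rfl rfl]
  let B : Subalgebra ℂ (Module.End ℂ (complexBetti X a)) :=
    { carrier := M
      mul_mem' := fun hS hT ↦ hmul _ hS _ hT
      one_mem' := hone
      add_mem' := fun hS hT ↦ M.add_mem hS hT
      zero_mem' := M.zero_mem
      algebraMap_mem' := fun c ↦ by
        rw [Algebra.algebraMap_eq_smul_one]
        exact M.smul_mem c hone }
  have hadj : Algebra.adjoin ℂ (M : Set (Module.End ℂ (complexBetti X a))) = B :=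
    le_antisymm (Algebra.adjoin_le fun x hx ↦ hx) fun x hx ↦ Algebra.subset_adjoin hx
  rw [hadj]
  rfl

/-- **DELIGNE–MILNE II PROP. 6.3 (NOTE) / 6.5 IN OPERATOR FORM, on the real carriers: for every smooth projective complex `X` of
dimension `n` and every degree `a`, the `ℂ`-algebra of endomorphisms of `Hᵃ(X(ℂ); ℂ)` induced by the absolute Hodge
classes `S^n(X ⊗ X) = span_ℂ AH^n(X ⊗ X)` (complex orientations) is SEMISIMPLE** — mod (N)+(E) + V-B3 + T1c + CS7 + CS8,
the named facts of record, displayed; unconditional otherwise (no `B(X)`: compare ring2-b05's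
`isSemisimpleRing_adjoin_algebraicOperators_of_standardConjectureBStar`, which needs `B(X, η)`). Finite-dimensional ⟹
Artinian; the nilpotent Jacobson radical is killed by the companion's nil ⟹ zero (`IsArtinianRing.isSemisimpleRing_iff_jacobson`). DM II 6.3 Note:
«the proposition shows that `Mor⁰_AH(X,X)` is a semisimple ℚ-algebra»; the proof there is Hodge positivity `Tr(uu') > 0`,
the proof here is Jannsen's. -- adapted from Summits/…/Theorems/Ring2HypothesesDescentAlgebraicCorrespondencesSemisimple.lean (§3)
[cite: DeligneMilne1982Tannakian, II Prop. 6.3 (Note) and Prop. 6.5] [cite: Jannsen1992, Thm. 1 and Lemma 1]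
[cite: Kleiman1968AlgebraicCycles, §3 Thm. 3.11] -/
theorem isSemisimpleRing_adjoin_absoluteHodgeOperators (hN : chartConjugation_canonical)
    (hex : ∀ ⦃n : ℕ⦄ ⦃X : SchemeOver ℂ⦄, IsSmoothProjective n X →
      ∀ (σ : ℂ ≃+* ℂ) (p : ℕ) (c : complexBetti X (2 * p)), ∃ s, IsConjugateClass σ X (2 * p) c s)
    (hZ : deligne1982_cycleClass_absoluteHodge) (hL : deligne1982_lefschetz_absoluteHodge_iff)
    (hcup : deligne1982_cupProduct_absoluteHodge) (hgys : deligne1982_gysinFst_absoluteHodge)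
    (hX : IsSmoothProjective n X) (a : ℕ) :
    IsSemisimpleRing (Algebra.adjoin ℂ ((Submodule.span ℂ {c : complexBetti (X ⊗ X) (2 * n) |
        IsAbsoluteHodgeClass (n + n) (X ⊗ X) n c}).map
        (corrAction complexOrientationFamily hX hX (rfl : a + 2 * n = a + 2 * n)) :
          Set (Module.End ℂ (complexBetti X a)))) := by
  set M := (Submodule.span ℂ {c : complexBetti (X ⊗ X) (2 * n) | IsAbsoluteHodgeClass (n + n) (X ⊗ X) n c}).map
    (corrAction complexOrientationFamily hX hX (rfl : a + 2 * n = a + 2 * n)) with hM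
  set B := Algebra.adjoin ℂ (M : Set (Module.End ℂ (complexBetti X a))) with hB
  have hBM : ∀ x : Module.End ℂ (complexBetti X a), x ∈ B ↔ x ∈ M := fun x ↦ by
    rw [← SetLike.mem_coe, hB, hM, adjoin_absoluteHodgeOperators_eq hN hex hZ hcup hgys hX a, SetLike.mem_coe]
  haveI : Module.Finite ℂ (complexBetti X a) := finite_complexBetti hX a
  haveI : IsArtinianRing B := IsArtinianRing.of_finite ℂ B
  rw [IsArtinianRing.isSemisimpleRing_iff_jacobson]
  refine eq_bot_iff.mpr fun x hx ↦ ?_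
  obtain ⟨k, hk⟩ := IsSemiprimaryRing.isNilpotent (R := B)
  have hnil : ∀ y : B, IsNilpotent ((y : Module.End ℂ (complexBetti X a)) * x) := fun y ↦ by
    have hyx := Ideal.pow_mem_pow (Ideal.mul_mem_left _ y hx) k
    rw [hk, Ideal.zero_eq_bot, Ideal.mem_bot] at hyx
    exact ⟨k, by rw [← Subalgebra.coe_mul, ← Subalgebra.coe_pow, hyx, Subalgebra.coe_zero]⟩
  obtain ⟨u, hu, hux⟩ := (hBM x).mp x.2
  have hx0 : (x : Module.End ℂ (complexBetti X a)) = 0 := by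
    rw [← hux]
    refine corrAction_eq_zero_of_forall_isNilpotent_comp_absoluteHodge hN hex hZ hL hcup hgys hX hu fun w hw ↦ ?_
    rw [hux, ← Module.End.mul_eq_comp]
    exact hnil ⟨_, (hBM _).mpr ⟨w, hw, rfl⟩⟩
  rw [Ideal.mem_bot]
  exact Subtype.ext hx0

/-- **`Hᵃ(X(ℂ); ℂ)` is a semisimple module over the algebra of absolute Hodge endo-correspondence operators** (mod the six
facts). [cite: DeligneMilne1982Tannakian, II Prop. 6.3 (Note) and Prop. 6.5] [cite: Jannsen1992, Thm. 1] -/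
theorem isSemisimpleModule_absoluteHodgeOperators (hN : chartConjugation_canonical)
    (hex : ∀ ⦃n : ℕ⦄ ⦃X : SchemeOver ℂ⦄, IsSmoothProjective n X →
      ∀ (σ : ℂ ≃+* ℂ) (p : ℕ) (c : complexBetti X (2 * p)), ∃ s, IsConjugateClass σ X (2 * p) c s)
    (hZ : deligne1982_cycleClass_absoluteHodge) (hL : deligne1982_lefschetz_absoluteHodge_iff)
    (hcup : deligne1982_cupProduct_absoluteHodge) (hgys : deligne1982_gysinFst_absoluteHodge)
    (hX : IsSmoothProjective n X) (a : ℕ) :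
    IsSemisimpleModule (Algebra.adjoin ℂ ((Submodule.span ℂ {c : complexBetti (X ⊗ X) (2 * n) |
        IsAbsoluteHodgeClass (n + n) (X ⊗ X) n c}).map
        (corrAction complexOrientationFamily hX hX (rfl : a + 2 * n = a + 2 * n)) :
          Set (Module.End ℂ (complexBetti X a)))) (complexBetti X a) := by
  haveI := isSemisimpleRing_adjoin_absoluteHodgeOperators hN hex hZ hL hcup hgys hX a
  infer_instance

/-- **COMPLETE REDUCIBILITY OF `Hᵃ(X(ℂ); ℂ)` UNDER ABSOLUTE HODGE CORRESPONDENCES** (mod the six facts): every `ℂ`-subspace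
`W ⊆ Hᵃ(X(ℂ); ℂ)` stable under `[u]_*` for all `u ∈ S^n(X ⊗ X)` (complex orientations) has a complement stable under all of
them. (DM II 6.5: every subobject of a motive for absolute Hodge cycles is a direct summand.)
-- adapted from Summits/…/Theorems/Ring2HypothesesDescentAlgebraicCorrespondencesSemisimple.lean (§3)
[cite: DeligneMilne1982Tannakian, II Prop. 6.5 and Lemma 6.6] [cite: Jannsen1992, Thm. 1] -/
theorem exists_isCompl_of_absoluteHodgeOperators_stable (hN : chartConjugation_canonical)
    (hex : ∀ ⦃n : ℕ⦄ ⦃X : SchemeOver ℂ⦄, IsSmoothProjective n X →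
      ∀ (σ : ℂ ≃+* ℂ) (p : ℕ) (c : complexBetti X (2 * p)), ∃ s, IsConjugateClass σ X (2 * p) c s)
    (hZ : deligne1982_cycleClass_absoluteHodge) (hL : deligne1982_lefschetz_absoluteHodge_iff)
    (hcup : deligne1982_cupProduct_absoluteHodge) (hgys : deligne1982_gysinFst_absoluteHodge)
    (hX : IsSmoothProjective n X) (a : ℕ) {W : Submodule ℂ (complexBetti X a)}
    (hW : ∀ u ∈ Submodule.span ℂ {c : complexBetti (X ⊗ X) (2 * n) | IsAbsoluteHodgeClass (n + n) (X ⊗ X) n c},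
      ∀ v ∈ W, corrAction complexOrientationFamily hX hX (rfl : a + 2 * n = a + 2 * n) u v ∈ W) :
    ∃ W' : Submodule ℂ (complexBetti X a), IsCompl W W' ∧
      ∀ u ∈ Submodule.span ℂ {c : complexBetti (X ⊗ X) (2 * n) | IsAbsoluteHodgeClass (n + n) (X ⊗ X) n c},
        ∀ v ∈ W', corrAction complexOrientationFamily hX hX (rfl : a + 2 * n = a + 2 * n) u v ∈ W' := by
  set M := (Submodule.span ℂ {c : complexBetti (X ⊗ X) (2 * n) | IsAbsoluteHodgeClass (n + n) (X ⊗ X) n c}).map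
    (corrAction complexOrientationFamily hX hX (rfl : a + 2 * n = a + 2 * n)) with hM
  set B := Algebra.adjoin ℂ (M : Set (Module.End ℂ (complexBetti X a))) with hB'
  have hBM : ∀ x : Module.End ℂ (complexBetti X a), x ∈ B ↔ x ∈ M := fun x ↦ by
    rw [← SetLike.mem_coe, hB', hM, adjoin_absoluteHodgeOperators_eq hN hex hZ hcup hgys hX a, SetLike.mem_coe]
  haveI := isSemisimpleModule_absoluteHodgeOperators hN hex hZ hL hcup hgys hX a
  have hWB : ∀ (T : B) (v : complexBetti X a), v ∈ W → (T : Module.End ℂ (complexBetti X a)) v ∈ W := by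
    rintro ⟨T, hT⟩ v hv
    obtain ⟨u, hu, rfl⟩ := (hBM T).mp hT
    exact hW u hu v hv
  let WB : Submodule B (complexBetti X a) :=
    { carrier := W
      add_mem' := fun hv hw ↦ W.add_mem hv hw
      zero_mem' := W.zero_mem
      smul_mem' := fun T v hv ↦ hWB T v hv }
  obtain ⟨WB', hcompl⟩ := exists_isCompl WB
  let W' : Submodule ℂ (complexBetti X a) :=
    { carrier := WB'
      add_mem' := fun hv hw ↦ WB'.add_mem hv hw
      zero_mem' := WB'.zero_mem
      smul_mem' := fun c v hv ↦ by
        have h := WB'.smul_mem (algebraMap ℂ B c) hv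
        have e : (algebraMap ℂ B c) • v = c • v := by
          change ((algebraMap ℂ B c : B) : Module.End ℂ (complexBetti X a)) v = c • v
          rw [Subalgebra.coe_algebraMap, Module.algebraMap_end_apply]
        rwa [e] at h }
  refine ⟨W', ⟨?_, ?_⟩, fun u hu v hv ↦ ?_⟩
  · rw [Submodule.disjoint_def]
    intro v hv hv'
    exact (Submodule.disjoint_def.mp hcompl.disjoint) v hv hv'
  · rw [codisjoint_iff_le_sup]
    intro v _
    have h : v ∈ WB ⊔ WB' := hcompl.codisjoint.top_le (Submodule.mem_top : v ∈ (⊤ : Submodule B _))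
    obtain ⟨y, hy, z, hz, rfl⟩ := Submodule.mem_sup.mp h
    exact Submodule.mem_sup.mpr ⟨y, hy, z, hz, rfl⟩
  · have hT : corrAction complexOrientationFamily hX hX (rfl : a + 2 * n = a + 2 * n) u ∈ B :=
      (hBM _).mpr ⟨u, hu, rfl⟩
    exact WB'.smul_mem (⟨_, hT⟩ : B) hv

end Semisimple

end Summit.HodgeConjecture.HodgeConjecture.Ring2.Hypotheses

end
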